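import Literature.NumberTheory.Automorphic.FiniteAdeleSchwartzBruhatFourier
import Literature.NumberTheory.Automorphic.RestrictedTensorProduct
import HarnessLib

/-!
# Factorizable Schwartz–Bruhat functions on `(𝔸_{K,f})^ι`

Kernel glue for the restricted tensor product structure of the finite-adelic Schwartz–Bruhat
space (Bump, *Automorphic forms and representations*, §3.3, restricted tensor products
`⊗'_v V_v` w.r.t. distinguished vectors; Flath 1979; Tate's thesis §4.2: the adelic
Schwartz–Bruhat functions are finite linear combinations of products `∏_v Φ_v` with
`Φ_v = 1_{𝒪_v}` for almost all `v`).

For a number field `K`, a finite index type `ι` and a finite place `v` we set up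

* `integralBox K ι v = 𝒪_v^ι ⊆ K_v^ι` (compact open) and the **unit vector**
  `unitVec K ι v = 1_{𝒪_v^ι} ∈ 𝒮(K_v^ι)` (`SchwartzBruhat (ι → K_v)` = locally constant compactly
  supported functions);
* the transposition `piTranspose K ι : (ι → 𝔸_{K,f}) ≃ Πʳ_v [K_v^ι, 𝒪_v^ι]`;
* for a restricted family `Φ = (Φ_v)_v` of local Schwartz–Bruhat functions (`Φ_v = unitVec` for
  almost all `v`; tree `RestrictedFamily`) the **pure tensor**
  `piProd K ι Φ : (ι → 𝔸_{K,f}) → ℂ`, `x ↦ ∏ᶠ_v Φ_v ((x_i)_v)_i`, its finite product formula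
  `piProd_eq_prod`, and the theorem `piProd_mem_schwartzBruhat`: a pure tensor is a
  Schwartz–Bruhat function on `(𝔸_{K,f})^ι`; `piProdSB K ι Φ` is the bundled element;
* the **coset indicators are pure tensors**: for a non-zero ideal `𝔫` and `c ∈ (𝔸_{K,f})^ι` the
  restricted family `cosetFamily K ι h𝔫 c = (1_{localCosetBox_v})_v` of local indicators
  (`localCosetBox K ι 𝔫 c v = {z | |z_i - (c_i)_v|_v ≤ |𝔫|_v ∀ i}`, equal to `𝒪_v^ι` for `v ∤ 𝔫`,
  `c` integral at `v`) has `piProd = 1_{c + (𝔫𝒪̂_K)^ι}` (`piProd_cosetFamily`, level boxes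
  `piLevelIdeal` of `FiniteAdeleSchwartzBruhatFourier`);
* **the pure tensors span**: every Schwartz–Bruhat function on `(𝔸_{K,f})^ι` is a finite linear
  combination of pure tensors (`mem_span_range_piProd`: a level `𝔫` from
  `exists_level_of_mem_schwartzBruhat`, finitely many cosets of `(𝔫𝒪̂_K)^ι` covering the
  support), so `span (range piProd) = 𝒮((𝔸_{K,f})^ι)` (`span_range_piProd_eq`) and
  `span (range piProdSB) = ⊤` (`span_range_piProdSB`).

This is the function-space input for the restricted tensor product structure
`𝒮((𝔸_{K,f})^ι) ≅ ⊗'_v 𝒮(K_v^ι)` (universal property: `RestrictedTensorProductFunctions`,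
transport in a sequel file).

Supporting topological lemmas on Mathlib's restricted products: boxes `{x | ∀ i, x i ∈ B i}` are
open (resp. compact, closed) when the `B i` are open and eventually equal to the `A i` (resp.
compact and eventually inside `A i`; closed).

Everything here is proved (kernel); no cited statements.
-/

open scoped RestrictedProduct
open Filter Function Set IsDedekindDomain NumberField

noncomputable section

namespace Literature.NumberTheory.Automorphic

/-! ### Boxes in restricted products -/

section Box

variable {ι : Type*} {R : ι → Type*} [∀ i, TopologicalSpace (R i)] {A : ∀ i, Set (R i)}

/-- A box `∏_i U_i` with `U_i` open and `U_i = A_i` for almost all `i` is open in the restricted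
product `Πʳ_i [R_i, A_i]` (all `A_i` open). [folklore] -/
theorem RestrictedProduct.isOpen_box (hA : ∀ i, IsOpen (A i)) {U : ∀ i, Set (R i)}
    (hU : ∀ i, IsOpen (U i)) (hUA : ∀ᶠ i in cofinite, U i = A i) :
    IsOpen {x : Πʳ i, [R i, A i] | ∀ i, x i ∈ U i} := by
  rw [eventually_cofinite] at hUA
  have heq : {x : Πʳ i, [R i, A i] | ∀ i, x i ∈ U i} =
      (⋂ i ∈ hUA.toFinset, (fun x : Πʳ i, [R i, A i] => x i) ⁻¹' U i) ∩
        {x : Πʳ i, [R i, A i] | ∀ i, U i = A i → x.1 i ∈ A i} := by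
    ext x
    simp only [mem_setOf_eq, mem_inter_iff, mem_iInter, Set.Finite.mem_toFinset, mem_preimage]
    constructor
    · intro h
      exact ⟨fun i _ => h i, fun i hi => hi ▸ h i⟩
    · rintro ⟨h1, h2⟩ i
      by_cases hi : U i = A i
      · rw [hi]; exact h2 i hi
      · exact h1 i hi
  rw [heq]
  exact (isOpen_biInter_finset fun i _ => (hU i).preimage (RestrictedProduct.continuous_eval i)).inter
    (RestrictedProduct.isOpen_forall_imp_mem hA)

/-- A box `∏_i B_i` with all `B_i` closed is closed in `Πʳ_i [R_i, A_i]`. [folklore] -/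
theorem RestrictedProduct.isClosed_box {B : ∀ i, Set (R i)} (hB : ∀ i, IsClosed (B i)) :
    IsClosed {x : Πʳ i, [R i, A i] | ∀ i, x i ∈ B i} := by
  have heq : {x : Πʳ i, [R i, A i] | ∀ i, x i ∈ B i} =
      ⋂ i, (fun x : Πʳ i, [R i, A i] => x i) ⁻¹' B i := by
    ext x; simp
  rw [heq]
  exact isClosed_iInter fun i => (hB i).preimage (RestrictedProduct.continuous_eval i)

/-- A box `∏_i B_i` with `B_i` compact and `B_i ⊆ A_i` for almost all `i` is compact in the
restricted product (Tychonoff inside the open stratum `Πʳ_i [R_i, A_i]_[𝓟 S]`). [folklore] -/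
theorem RestrictedProduct.isCompact_box {B : ∀ i, Set (R i)} (hB : ∀ i, IsCompact (B i))
    (hBA : ∀ᶠ i in cofinite, B i ⊆ A i) :
    IsCompact {x : Πʳ i, [R i, A i] | ∀ i, x i ∈ B i} := by
  set S : Set ι := {i | B i ⊆ A i}
  have hS : cofinite ≤ 𝓟 S := le_principal_iff.mpr hBA
  set Q : Set (Π i, R i) := univ.pi B
  have hQ : IsCompact Q := isCompact_univ_pi hB
  have hQS : Q ⊆ range ((↑) : Πʳ i, [R i, A i]_[𝓟 S] → Π i, R i) := by
    rw [RestrictedProduct.range_coe_principal]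
    exact fun f hf i hi => hi (hf i (mem_univ i))
  have hK : IsCompact (((↑) : Πʳ i, [R i, A i]_[𝓟 S] → Π i, R i) ⁻¹' Q) :=
    (RestrictedProduct.isEmbedding_coe_of_principal.isCompact_preimage_iff hQS).mpr hQ
  have heq : {x : Πʳ i, [R i, A i] | ∀ i, x i ∈ B i} =
      RestrictedProduct.inclusion R A hS ''
        (((↑) : Πʳ i, [R i, A i]_[𝓟 S] → Π i, R i) ⁻¹' Q) := by
    ext x
    constructor
    · intro hx
      have hx' : ∀ᶠ i in 𝓟 S, x i ∈ A i := eventually_principal.mpr fun i hi => hi (hx i)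
      obtain ⟨x', rfl⟩ := RestrictedProduct.exists_inclusion_eq_of_eventually R A hS hx'
      exact ⟨x', fun i _ => hx i, rfl⟩
    · rintro ⟨x', hx', rfl⟩ i
      exact hx' i (mem_univ i)
  rw [heq]
  exact hK.image (RestrictedProduct.continuous_inclusion hS)

end Box

/-! ### Indicators of clopen sets -/

/-- The indicator function of a clopen set (with any constant value) is locally constant.
[folklore] -/
theorem isLocallyConstant_indicator_const {X : Type*} [TopologicalSpace X] {U : Set X}
    (hU : IsClopen U) {M : Type*} [Zero M] (c : M) :
    IsLocallyConstant (U.indicator fun _ => c) := by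
  rw [IsLocallyConstant.iff_exists_open]
  intro y
  by_cases hy : y ∈ U
  · exact ⟨U, hU.isOpen, hy, fun z hz => by
      rw [Set.indicator_of_mem hz, Set.indicator_of_mem hy]⟩
  · exact ⟨Uᶜ, hU.compl.isOpen, hy, fun z hz => by
      rw [Set.indicator_of_notMem hz, Set.indicator_of_notMem hy]⟩

/-- The indicator function of a compact open (hence clopen) set is a Schwartz–Bruhat function.
[folklore] -/
theorem indicator_one_mem_schwartzBruhat {X : Type*} [TopologicalSpace X] {U : Set X}
    (hU : IsClopen U) (hUc : IsCompact U) :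
    U.indicator (fun _ => (1 : ℂ)) ∈ SchwartzBruhat X := by
  rw [mem_schwartzBruhat_iff]
  exact ⟨isLocallyConstant_indicator_const hU 1,
    HasCompactSupport.intro' hUc hU.isClosed fun y hy => Set.indicator_of_notMem hy _⟩

/-! ### Local data at a finite place: the box `𝒪_v^ι` and the unit vector `1_{𝒪_v^ι}` -/

section Local

variable (K : Type) [Field K] [NumberField K] (ι : Type) (v : HeightOneSpectrum (𝓞 K))

/-- The integral box `𝒪_v^ι ⊆ K_v^ι`. [folklore] -/
def integralBox : Set (ι → v.adicCompletion K) :=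
  Set.pi Set.univ fun _ => (v.adicCompletionIntegers K : Set (v.adicCompletion K))

variable {K ι v} in
/-- Membership in the integral box is coordinatewise integrality. [folklore] -/
theorem mem_integralBox_iff {z : ι → v.adicCompletion K} :
    z ∈ integralBox K ι v ↔ ∀ i, z i ∈ v.adicCompletionIntegers K := by
  simp [integralBox, Set.mem_pi]

/-- `0 ∈ 𝒪_v^ι`. [folklore] -/
theorem zero_mem_integralBox : (0 : ι → v.adicCompletion K) ∈ integralBox K ι v :=
  mem_integralBox_iff.mpr fun _ => zero_mem _

/-- `𝒪_v^ι` is open (for finite `ι`). [folklore] -/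
theorem isOpen_integralBox [Finite ι] : IsOpen (integralBox K ι v) :=
  isOpen_set_pi Set.finite_univ fun _ _ => Valued.isOpen_valuationSubring _

/-- `𝒪_v^ι` is compact (`𝒪_v` is compact: tree `compactSpace_adicCompletionIntegers'`). [folklore] -/
theorem isCompact_integralBox : IsCompact (integralBox K ι v) :=
  isCompact_univ_pi fun _ =>
    isCompact_iff_compactSpace.mpr (compactSpace_adicCompletionIntegers' K v)

/-- `𝒪_v^ι` is closed. [folklore] -/
theorem isClosed_integralBox : IsClosed (integralBox K ι v) :=
  isClosed_set_pi fun _ _ => Valued.isClosed_valuationSubring _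

/-- `𝒪_v^ι` is clopen (for finite `ι`). [folklore] -/
theorem isClopen_integralBox [Finite ι] : IsClopen (integralBox K ι v) :=
  ⟨isClosed_integralBox K ι v, isOpen_integralBox K ι v⟩

/-- The **unit vector** at `v`: the characteristic function `1_{𝒪_v^ι} ∈ 𝒮(K_v^ι)` (Bump §3.3:
the distinguished vectors of the restricted tensor product; Tate: `f_v = 1_{𝒪_v}` a.e.).
[folklore] -/
noncomputable def unitVec [Finite ι] : ↥(SchwartzBruhat (ι → v.adicCompletion K)) :=
  ⟨(integralBox K ι v).indicator fun _ => 1,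
    indicator_one_mem_schwartzBruhat (isClopen_integralBox K ι v) (isCompact_integralBox K ι v)⟩

/-- Underlying function of the unit vector. [folklore] -/
@[simp] theorem coe_unitVec [Finite ι] :
    ((unitVec K ι v : ↥(SchwartzBruhat (ι → v.adicCompletion K))) :
      (ι → v.adicCompletion K) → ℂ) = (integralBox K ι v).indicator fun _ => 1 := rfl

variable {K ι v} in
/-- The unit vector is `1` on the integral box. [folklore] -/
theorem unitVec_apply_of_mem [Finite ι] {z : ι → v.adicCompletion K} (hz : z ∈ integralBox K ι v) :
    (unitVec K ι v : (ι → v.adicCompletion K) → ℂ) z = 1 := by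
  rw [coe_unitVec, Set.indicator_of_mem hz]

variable {K ι v} in
/-- The unit vector is `0` off the integral box. [folklore] -/
theorem unitVec_apply_of_notMem [Finite ι] {z : ι → v.adicCompletion K}
    (hz : z ∉ integralBox K ι v) :
    (unitVec K ι v : (ι → v.adicCompletion K) → ℂ) z = 0 := by
  rw [coe_unitVec, Set.indicator_of_notMem hz]

end Local

/-! ### Transposition `(ι → 𝔸_{K,f}) ≃ Πʳ_v [K_v^ι, 𝒪_v^ι]` -/

section Transpose

variable (K : Type) [Field K] [NumberField K] (ι : Type) [Finite ι]

/-- The transposition `(x_i)_i ↦ (((x_i)_v)_i)_v`: a finite tuple of finite adeles is the same as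
a restricted family of local tuples w.r.t. the integral boxes `𝒪_v^ι` (finite intersections of
cofinite sets are cofinite). [folklore] -/
def piTranspose : (ι → FiniteAdeleRing (𝓞 K) K) ≃
    Πʳ v : HeightOneSpectrum (𝓞 K), [ι → v.adicCompletion K, integralBox K ι v] where
  toFun x := ⟨fun v i => x i v,
    (eventually_all.mpr fun i => (x i).2).mono fun _ hv => mem_integralBox_iff.mpr hv⟩
  invFun y i := ⟨fun v => y v i, y.2.mono fun _ hv => mem_integralBox_iff.mp hv i⟩
  left_inv _ := rfl
  right_inv _ := rfl

/-- Components of the transposition. [folklore] -/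
@[simp] theorem piTranspose_apply (x : ι → FiniteAdeleRing (𝓞 K) K)
    (v : HeightOneSpectrum (𝓞 K)) (i : ι) : piTranspose K ι x v i = x i v := rfl

/-- Components of the inverse transposition. [folklore] -/
@[simp] theorem piTranspose_symm_apply
    (y : Πʳ v : HeightOneSpectrum (𝓞 K), [ι → v.adicCompletion K, integralBox K ι v])
    (i : ι) (v : HeightOneSpectrum (𝓞 K)) : (piTranspose K ι).symm y i v = y v i := rfl

end Transpose

/-! ### Pure tensors `∏_v Φ_v` as functions on `(𝔸_{K,f})^ι` -/

section Products

variable (K : Type) [Field K] [NumberField K] (ι : Type) [Finite ι]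

/-- Restricted families `(Φ_v)_v` of local Schwartz–Bruhat functions `Φ_v ∈ 𝒮(K_v^ι)` with
`Φ_v = 1_{𝒪_v^ι}` for almost all `v` (tree `RestrictedFamily`). [folklore] -/
abbrev LocalSBFamily : Type _ :=
  RestrictedFamily (fun v : HeightOneSpectrum (𝓞 K) => ↥(SchwartzBruhat (ι → v.adicCompletion K)))
    (fun v => unitVec K ι v)

variable {K ι}

/-- The local factor `Φ_v((x_i)_v)_i` of a pure tensor at `x ∈ (𝔸_{K,f})^ι`. [folklore] -/
def localFactor (Φ : LocalSBFamily K ι) (x : ι → FiniteAdeleRing (𝓞 K) K)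
    (v : HeightOneSpectrum (𝓞 K)) : ℂ :=
  (Φ v : (ι → v.adicCompletion K) → ℂ) fun i => x i v

/-- Unfolding the local factor. [folklore] -/
theorem localFactor_apply (Φ : LocalSBFamily K ι) (x : ι → FiniteAdeleRing (𝓞 K) K)
    (v : HeightOneSpectrum (𝓞 K)) :
    localFactor Φ x v = (Φ v : (ι → v.adicCompletion K) → ℂ) fun i => x i v := rfl

variable (K ι) in
/-- The **pure tensor** `∏_v Φ_v` as a function on `(𝔸_{K,f})^ι`: `x ↦ ∏ᶠ_v Φ_v(((x_i)_v)_i)`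
(a finite product: almost every factor is `1_{𝒪_v^ι}` evaluated at an integral vector).
[folklore] -/
def piProd (Φ : LocalSBFamily K ι) (x : ι → FiniteAdeleRing (𝓞 K) K) : ℂ :=
  ∏ᶠ v, localFactor Φ x v

/-- Off a finite set `T` containing the exceptional places of `Φ` and of `x`, every local factor
is `1`. [folklore] -/
theorem mulSupport_localFactor_subset (Φ : LocalSBFamily K ι) (x : ι → FiniteAdeleRing (𝓞 K) K)
    (T : Finset (HeightOneSpectrum (𝓞 K))) (hΦ : ∀ v ∉ T, Φ v = unitVec K ι v)
    (hx : ∀ v ∉ T, ∀ i, x i v ∈ v.adicCompletionIntegers K) :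
    mulSupport (localFactor Φ x) ⊆ ↑T := by
  intro v hv
  by_contra hvT
  rw [Finset.mem_coe] at hvT
  apply hv
  rw [localFactor_apply, hΦ v hvT]
  exact unitVec_apply_of_mem (mem_integralBox_iff.mpr (hx v hvT))

/-- There is a finite set of places off which `Φ_v = 1_{𝒪_v^ι}` and `x` is integral. [folklore] -/
theorem exists_finset_exceptional (Φ : LocalSBFamily K ι) (x : ι → FiniteAdeleRing (𝓞 K) K) :
    ∃ T : Finset (HeightOneSpectrum (𝓞 K)), (∀ v ∉ T, Φ v = unitVec K ι v) ∧
      ∀ v ∉ T, ∀ i, x i v ∈ v.adicCompletionIntegers K := by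
  have h1 : ∀ᶠ v in cofinite, Φ v = unitVec K ι v := Φ.eventually_eq
  have h2 : ∀ᶠ v in cofinite, ∀ i, x i v ∈ v.adicCompletionIntegers K :=
    eventually_all.mpr fun i => (x i).2
  have h := h1.and h2
  rw [eventually_cofinite] at h
  refine ⟨h.toFinset, fun v hv => (not_not.mp fun hn => hv (h.mem_toFinset.mpr hn)).1,
    fun v hv => (not_not.mp fun hn => hv (h.mem_toFinset.mpr hn)).2⟩

/-- The local factors of a pure tensor at a point have finite multiplicative support. [folklore] -/
theorem finite_mulSupport_localFactor (Φ : LocalSBFamily K ι) (x : ι → FiniteAdeleRing (𝓞 K) K) :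
    (mulSupport (localFactor Φ x)).Finite := by
  obtain ⟨T, h1, h2⟩ := exists_finset_exceptional Φ x
  exact T.finite_toSet.subset (mulSupport_localFactor_subset Φ x T h1 h2)

/-- **Finite product formula**: `(∏_v Φ_v)(x) = ∏_{v ∈ T} Φ_v(x_v)` for any finite `T` containing
the exceptional places of `Φ` and of `x`. [folklore] -/
theorem piProd_eq_prod (Φ : LocalSBFamily K ι) (x : ι → FiniteAdeleRing (𝓞 K) K)
    (T : Finset (HeightOneSpectrum (𝓞 K))) (hΦ : ∀ v ∉ T, Φ v = unitVec K ι v)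
    (hx : ∀ v ∉ T, ∀ i, x i v ∈ v.adicCompletionIntegers K) :
    piProd K ι Φ x = ∏ v ∈ T, localFactor Φ x v :=
  finprod_eq_prod_of_mulSupport_subset _ (mulSupport_localFactor_subset Φ x T hΦ hx)

/-- A pure tensor vanishes at `x` as soon as one local factor does. [folklore] -/
theorem piProd_eq_zero_of_localFactor_eq_zero (Φ : LocalSBFamily K ι)
    (x : ι → FiniteAdeleRing (𝓞 K) K) (v : HeightOneSpectrum (𝓞 K))
    (hv : localFactor Φ x v = 0) : piProd K ι Φ x = 0 :=
  finprod_eq_zero _ v hv (finite_mulSupport_localFactor Φ x)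

/-- The pure tensor is the W4-a product function `prodFun` transported along `piTranspose`
(definitional). [folklore] -/
theorem piProd_eq_finprod_piTranspose (Φ : LocalSBFamily K ι) (x : ι → FiniteAdeleRing (𝓞 K) K) :
    piProd K ι Φ x = ∏ᶠ v, (Φ v : (ι → v.adicCompletion K) → ℂ) (piTranspose K ι x v) := rfl

/-- The set of places where a restricted family is not the unit vector is finite. [folklore] -/
theorem finite_setOf_ne_unitVec (Φ : LocalSBFamily K ι) :
    {v | Φ v ≠ unitVec K ι v}.Finite := by
  have h : ∀ᶠ v in cofinite, Φ v = unitVec K ι v := Φ.eventually_eq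
  rwa [eventually_cofinite] at h

/-- The **integrality box off `T`**: tuples `x` with `(x_i)_v ∈ 𝒪_v` for all `i` and all
`v ∉ T`. [folklore] -/
def offBox (T : Finset (HeightOneSpectrum (𝓞 K))) : Set (ι → FiniteAdeleRing (𝓞 K) K) :=
  {x | ∀ i, ∀ v, v ∉ T → x i v ∈ v.adicCompletionIntegers K}

/-- The integrality box off `T` is open. [folklore] -/
theorem isOpen_offBox (T : Finset (HeightOneSpectrum (𝓞 K))) : IsOpen (offBox (ι := ι) T) := by
  have heq : offBox (ι := ι) (K := K) T =
      ⋂ i, (fun x : ι → FiniteAdeleRing (𝓞 K) K => x i) ⁻¹'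
        {a : FiniteAdeleRing (𝓞 K) K | ∀ v, v ∉ T →
          a.1 v ∈ (v.adicCompletionIntegers K : Set (v.adicCompletion K))} := by
    ext x
    simp only [offBox, mem_setOf_eq, mem_iInter, mem_preimage, SetLike.mem_coe]
    exact Iff.rfl
  rw [heq]
  exact isOpen_iInter_of_finite fun i =>
    (RestrictedProduct.isOpen_forall_imp_mem (fun v => Valued.isOpen_valuationSubring _)).preimage
      (continuous_apply i)

omit [Finite ι] in
/-- The integrality box off `T` is closed. [folklore] -/
theorem isClosed_offBox (T : Finset (HeightOneSpectrum (𝓞 K))) : IsClosed (offBox (ι := ι) T) := by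
  have heq : offBox (ι := ι) (K := K) T =
      ⋂ i, ⋂ v, ⋂ (_ : v ∉ T), (fun x : ι → FiniteAdeleRing (𝓞 K) K => x i v) ⁻¹'
        (v.adicCompletionIntegers K : Set (v.adicCompletion K)) := by
    ext x
    simp only [offBox, mem_setOf_eq, mem_iInter, mem_preimage, SetLike.mem_coe]
  rw [heq]
  refine isClosed_iInter fun i => isClosed_iInter fun v => isClosed_iInter fun _ => ?_
  exact (Valued.isClosed_valuationSubring _).preimage
    ((RestrictedProduct.continuous_eval v).comp (continuous_apply i))

/-- On the integrality box off the exceptional set `T` of `Φ`, the pure tensor is the finite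
product over `T`; off it, it vanishes. [folklore] -/
theorem piProd_eq_indicator (Φ : LocalSBFamily K ι) (T : Finset (HeightOneSpectrum (𝓞 K)))
    (hΦ : ∀ v ∉ T, Φ v = unitVec K ι v) :
    piProd K ι Φ = (offBox T).indicator fun x => ∏ v ∈ T, localFactor Φ x v := by
  funext x
  by_cases hx : x ∈ offBox T
  · rw [Set.indicator_of_mem hx]
    exact piProd_eq_prod Φ x T hΦ fun v hv i => hx i v hv
  · rw [Set.indicator_of_notMem hx]
    simp only [offBox, mem_setOf_eq, not_forall] at hx
    obtain ⟨i, v, hvT, hxv⟩ := hx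
    refine piProd_eq_zero_of_localFactor_eq_zero Φ x v ?_
    rw [localFactor_apply, hΦ v hvT]
    exact unitVec_apply_of_notMem fun h => hxv (mem_integralBox_iff.mp h i)

/-- Each local factor `x ↦ Φ_v(x_v)` is locally constant on `(𝔸_{K,f})^ι`. [folklore] -/
theorem isLocallyConstant_localFactor (Φ : LocalSBFamily K ι) (v : HeightOneSpectrum (𝓞 K)) :
    IsLocallyConstant fun x : ι → FiniteAdeleRing (𝓞 K) K => localFactor Φ x v := by
  have hΦ := (mem_schwartzBruhat_iff.mp (Φ v).2).1
  exact hΦ.comp_continuous (continuous_pi fun i =>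
    (RestrictedProduct.continuous_eval v).comp (continuous_apply i))

/-- A finite product of the local factors is locally constant. [folklore] -/
theorem isLocallyConstant_prod_localFactor (Φ : LocalSBFamily K ι)
    (T : Finset (HeightOneSpectrum (𝓞 K))) :
    IsLocallyConstant fun x : ι → FiniteAdeleRing (𝓞 K) K => ∏ v ∈ T, localFactor Φ x v := by
  classical
  induction T using Finset.induction_on with
  | empty =>
    simp only [Finset.prod_empty]
    exact IsLocallyConstant.const (1 : ℂ)
  | insert v T hv ih =>
    simp_rw [Finset.prod_insert hv]
    exact (isLocallyConstant_localFactor Φ v).comp₂ ih (· * ·)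

/-- The support of a pure tensor lies in a compact box: `x_i v ∈ pr_i (tsupport Φ_v)` for
`v ∈ T` and `x_i v ∈ 𝒪_v` for `v ∉ T`. [folklore] -/
theorem exists_isCompact_superset_support_piProd (Φ : LocalSBFamily K ι) :
    ∃ C : Set (ι → FiniteAdeleRing (𝓞 K) K), IsCompact C ∧ ∀ x ∉ C, piProd K ι Φ x = 0 := by
  classical
  obtain ⟨T, hT⟩ : ∃ T : Finset (HeightOneSpectrum (𝓞 K)), ∀ v ∉ T, Φ v = unitVec K ι v :=
    ⟨(finite_setOf_ne_unitVec Φ).toFinset, fun v hv =>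
      not_not.mp fun hn => hv ((finite_setOf_ne_unitVec Φ).mem_toFinset.mpr hn)⟩
  -- the local compact sets
  let B : ι → ∀ v : HeightOneSpectrum (𝓞 K), Set (v.adicCompletion K) := fun i v =>
    if v ∈ T then (fun z : ι → v.adicCompletion K => z i) '' tsupport
      ((Φ v : (ι → v.adicCompletion K) → ℂ))
    else (v.adicCompletionIntegers K : Set (v.adicCompletion K))
  have hBc : ∀ i v, IsCompact (B i v) := by
    intro i v
    by_cases hv : v ∈ T
    · simp only [B, hv, if_true]
      exact (mem_schwartzBruhat_iff.mp (Φ v).2).2.isCompact.image (continuous_apply i)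
    · simp only [B, hv, if_false]
      exact isCompact_iff_compactSpace.mpr (compactSpace_adicCompletionIntegers' K v)
  have hBA : ∀ i, ∀ᶠ v in cofinite,
      B i v ⊆ (v.adicCompletionIntegers K : Set (v.adicCompletion K)) := by
    intro i
    refine T.eventually_cofinite_notMem.mono fun v hv => ?_
    simp only [B, hv, if_false]
    exact subset_rfl
  let C : Set (ι → FiniteAdeleRing (𝓞 K) K) :=
    Set.pi Set.univ fun i => {a : FiniteAdeleRing (𝓞 K) K | ∀ v, a v ∈ B i v}
  have hC : IsCompact C :=
    isCompact_univ_pi fun i => RestrictedProduct.isCompact_box (hBc i) (hBA i)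
  refine ⟨C, hC, fun x hx => ?_⟩
  simp only [C, Set.mem_pi, Set.mem_univ, true_implies, Set.mem_setOf_eq, not_forall] at hx
  obtain ⟨i, v, hiv⟩ := hx
  refine piProd_eq_zero_of_localFactor_eq_zero Φ x v ?_
  by_cases hv : v ∈ T
  · simp only [B, hv, if_true] at hiv
    rw [localFactor_apply]
    refine image_eq_zero_of_notMem_tsupport fun hmem => hiv ⟨fun j => x j v, hmem, rfl⟩
  · simp only [B, hv, if_false, SetLike.mem_coe] at hiv
    rw [localFactor_apply, hT v hv]
    exact unitVec_apply_of_notMem fun h => hiv (mem_integralBox_iff.mp h i)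

/-- **A pure tensor `∏_v Φ_v` is a Schwartz–Bruhat function on `(𝔸_{K,f})^ι`** (locally constant
and compactly supported). [folklore] -/
theorem piProd_mem_schwartzBruhat (Φ : LocalSBFamily K ι) :
    piProd K ι Φ ∈ SchwartzBruhat (ι → FiniteAdeleRing (𝓞 K) K) := by
  classical
  rw [mem_schwartzBruhat_iff]
  obtain ⟨T, hT⟩ : ∃ T : Finset (HeightOneSpectrum (𝓞 K)), ∀ v ∉ T, Φ v = unitVec K ι v :=
    ⟨(finite_setOf_ne_unitVec Φ).toFinset, fun v hv =>
      not_not.mp fun hn => hv ((finite_setOf_ne_unitVec Φ).mem_toFinset.mpr hn)⟩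
  constructor
  · rw [piProd_eq_indicator Φ T hT]
    have hind : (offBox T).indicator (fun x => ∏ v ∈ T, localFactor Φ x v) =
        (fun x => ∏ v ∈ T, localFactor Φ x v) * (offBox T).indicator fun _ => (1 : ℂ) := by
      funext x
      by_cases hx : x ∈ offBox T
      · simp [Set.indicator_of_mem hx]
      · simp [Set.indicator_of_notMem hx]
    rw [hind]
    exact (isLocallyConstant_prod_localFactor Φ T).mul
      (isLocallyConstant_indicator_const ⟨isClosed_offBox T, isOpen_offBox T⟩ (1 : ℂ))
  · obtain ⟨C, hC, hzero⟩ := exists_isCompact_superset_support_piProd Φ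
    exact HasCompactSupport.intro hC fun x hx => hzero x hx

end Products

/-! ### Coset indicators `1_{c + (𝔫𝒪̂_K)^ι}` are pure tensors -/

section Coset

variable (K : Type) [Field K] [NumberField K] (ι : Type) [Finite ι]

/-- Closed valuation balls `{y | |y|_v ≤ r}`, `r ≠ 0`, of `K_v` are clopen (Mathlib
`Valued.isClopen_closedBall`, the radius realised as `|z|_v`, `z ∈ K`). [folklore] -/
theorem isClopen_setOf_valued_le (v : HeightOneSpectrum (𝓞 K)) {r : WithZero (Multiplicative ℤ)}
    (hr : r ≠ 0) : IsClopen {y : v.adicCompletion K | Valued.v y ≤ r} := by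
  obtain ⟨z, hz⟩ := v.valuation_surjective K r
  have hz' : Valued.v (z : v.adicCompletion K) = r := by
    rw [HeightOneSpectrum.valuedAdicCompletion_eq_valuation', hz]
  have hne : Valued.v.restrict (z : v.adicCompletion K) ≠ 0 := by
    rw [Ne, Valuation.restrict_eq_zero_iff, hz']
    exact hr
  have h := Valued.isClopen_closedBall (v.adicCompletion K) hne
  simp only [Valuation.restrict_le_iff, hz'] at h
  exact h

/-- The **local coset box** at `v` of the coset `c + (𝔫𝒪̂_K)^ι`: local tuples `z` with
`|z_i - (c_i)_v|_v ≤ |𝔫|_v` for all `i`. [folklore] -/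
def localCosetBox (𝔫 : Ideal (𝓞 K)) (c : ι → FiniteAdeleRing (𝓞 K) K)
    (v : HeightOneSpectrum (𝓞 K)) : Set (ι → v.adicCompletion K) :=
  {z | ∀ i, Valued.v (z i - c i v) ≤ idealRadius K v 𝔫}

/-- Local coset boxes are clopen. [folklore] -/
theorem isClopen_localCosetBox (𝔫 : Ideal (𝓞 K)) (c : ι → FiniteAdeleRing (𝓞 K) K)
    (v : HeightOneSpectrum (𝓞 K)) : IsClopen (localCosetBox K ι 𝔫 c v) := by
  have heq : localCosetBox K ι 𝔫 c v = ⋂ i, (fun z : ι → v.adicCompletion K => z i - c i v) ⁻¹'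
      {y : v.adicCompletion K | Valued.v y ≤ idealRadius K v 𝔫} := by
    ext z
    simp [localCosetBox]
  rw [heq]
  exact isClopen_iInter_of_finite fun i =>
    (isClopen_setOf_valued_le K v (WithZero.exp_ne_zero : idealRadius K v 𝔫 ≠ 0)).preimage
      ((continuous_apply i).sub continuous_const)

omit [Finite ι] in
/-- A local coset box lies in the translate `c_v + 𝒪_v^ι` of the integral box (`|𝔫|_v ≤ 1`).
[folklore] -/
theorem localCosetBox_subset (𝔫 : Ideal (𝓞 K)) (c : ι → FiniteAdeleRing (𝓞 K) K)
    (v : HeightOneSpectrum (𝓞 K)) :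
    localCosetBox K ι 𝔫 c v ⊆ (fun z => (fun i => c i v) + z) '' integralBox K ι v := by
  intro z hz
  refine ⟨z - fun i => c i v, mem_integralBox_iff.mpr fun i => ?_, add_sub_cancel _ _⟩
  refine (HeightOneSpectrum.mem_adicCompletionIntegers (𝓞 K) K v).mpr ?_
  exact (hz i).trans (idealRadius_le_one' v 𝔫)

/-- Local coset boxes are compact. [folklore] -/
theorem isCompact_localCosetBox (𝔫 : Ideal (𝓞 K)) (c : ι → FiniteAdeleRing (𝓞 K) K)
    (v : HeightOneSpectrum (𝓞 K)) : IsCompact (localCosetBox K ι 𝔫 c v) :=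
  ((isCompact_integralBox K ι v).image (continuous_const_add (fun i => c i v))).of_isClosed_subset
    (isClopen_localCosetBox K ι 𝔫 c v).isClosed (localCosetBox_subset K ι 𝔫 c v)

omit [Finite ι] in
/-- For `v ∤ 𝔫` and `c` integral at `v`, the local coset box IS the integral box `𝒪_v^ι`.
[folklore] -/
theorem localCosetBox_eq_integralBox {𝔫 : Ideal (𝓞 K)} (h𝔫 : 𝔫 ≠ 0)
    {c : ι → FiniteAdeleRing (𝓞 K) K} {v : HeightOneSpectrum (𝓞 K)} (hv : ¬ v.asIdeal ∣ 𝔫)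
    (hc : ∀ i, c i v ∈ v.adicCompletionIntegers K) :
    localCosetBox K ι 𝔫 c v = integralBox K ι v := by
  ext z
  simp only [localCosetBox, mem_setOf_eq, mem_integralBox_iff, idealRadius_eq_one_of_not_dvd h𝔫 hv]
  refine forall_congr' fun i => ?_
  rw [← HeightOneSpectrum.mem_adicCompletionIntegers (𝓞 K) K v]
  constructor
  · intro h
    have h' := add_mem h (hc i)
    rwa [sub_add_cancel] at h'
  · intro h
    exact sub_mem h (hc i)

/-- The **restricted family of local coset indicators** of the coset `c + (𝔫𝒪̂_K)^ι` (`𝔫 ≠ 0`):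
`v ↦ 1_{localCosetBox}`; it is the unit vector for `v ∤ 𝔫` with `c` integral at `v` (almost
all `v`). [folklore] -/
def cosetFamily {𝔫 : Ideal (𝓞 K)} (h𝔫 : 𝔫 ≠ 0) (c : ι → FiniteAdeleRing (𝓞 K) K) :
    LocalSBFamily K ι :=
  ⟨fun v => ⟨(localCosetBox K ι 𝔫 c v).indicator fun _ => 1,
      indicator_one_mem_schwartzBruhat (isClopen_localCosetBox K ι 𝔫 c v)
        (isCompact_localCosetBox K ι 𝔫 c v)⟩, by
    have h1 : ∀ᶠ v : HeightOneSpectrum (𝓞 K) in cofinite, ¬ v.asIdeal ∣ 𝔫 := by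
      rw [eventually_cofinite]
      simpa using Ideal.finite_factors h𝔫
    have h2 : ∀ᶠ v : HeightOneSpectrum (𝓞 K) in cofinite, ∀ i, c i v ∈ v.adicCompletionIntegers K :=
      eventually_all.mpr fun i => (c i).2
    refine (h1.and h2).mono fun v hv => ?_
    show _ = unitVec K ι v
    apply Subtype.ext
    show (localCosetBox K ι 𝔫 c v).indicator (fun _ => (1 : ℂ)) =
      (integralBox K ι v).indicator fun _ => 1
    rw [localCosetBox_eq_integralBox K ι h𝔫 hv.1 hv.2]⟩

/-- Underlying local functions of the coset family. [folklore] -/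
@[simp] theorem coe_cosetFamily_apply {𝔫 : Ideal (𝓞 K)} (h𝔫 : 𝔫 ≠ 0)
    (c : ι → FiniteAdeleRing (𝓞 K) K) (v : HeightOneSpectrum (𝓞 K)) :
    ((cosetFamily K ι h𝔫 c v : ↥(SchwartzBruhat (ι → v.adicCompletion K))) :
      (ι → v.adicCompletion K) → ℂ) = (localCosetBox K ι 𝔫 c v).indicator fun _ => 1 := rfl

omit [Finite ι] in
/-- `x - c ∈ (𝔫𝒪̂_K)^ι` iff every local tuple `x_v` lies in the local coset box of `c`.
[folklore] -/
theorem sub_mem_piLevelIdeal_iff {𝔫 : Ideal (𝓞 K)} {x c : ι → FiniteAdeleRing (𝓞 K) K} :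
    x - c ∈ piLevelIdeal K ι 𝔫 ↔ ∀ v, (fun i => x i v) ∈ localCosetBox K ι 𝔫 c v := by
  rw [mem_piLevelIdeal_iff K]
  simp only [mem_levelIdeal_iff, localCosetBox, mem_setOf_eq]
  constructor
  · intro h v i
    exact h i v
  · intro h i v
    exact h v i

/-- On the coset `c + (𝔫𝒪̂_K)^ι` the pure tensor of the coset family is `1`. [folklore] -/
theorem piProd_cosetFamily_of_mem {𝔫 : Ideal (𝓞 K)} (h𝔫 : 𝔫 ≠ 0)
    {x c : ι → FiniteAdeleRing (𝓞 K) K} (h : x - c ∈ piLevelIdeal K ι 𝔫) :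
    piProd K ι (cosetFamily K ι h𝔫 c) x = 1 := by
  refine finprod_eq_one_of_forall_eq_one fun v => ?_
  rw [localFactor_apply, coe_cosetFamily_apply]
  exact Set.indicator_of_mem ((sub_mem_piLevelIdeal_iff K ι).mp h v) _

/-- Off the coset `c + (𝔫𝒪̂_K)^ι` the pure tensor of the coset family is `0`. [folklore] -/
theorem piProd_cosetFamily_of_notMem {𝔫 : Ideal (𝓞 K)} (h𝔫 : 𝔫 ≠ 0)
    {x c : ι → FiniteAdeleRing (𝓞 K) K} (h : x - c ∉ piLevelIdeal K ι 𝔫) :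
    piProd K ι (cosetFamily K ι h𝔫 c) x = 0 := by
  rw [sub_mem_piLevelIdeal_iff K ι, not_forall] at h
  obtain ⟨v, hv⟩ := h
  refine piProd_eq_zero_of_localFactor_eq_zero _ x v ?_
  rw [localFactor_apply, coe_cosetFamily_apply]
  exact Set.indicator_of_notMem hv _

/-- **Coset indicators are pure tensors**: `1_{c + (𝔫𝒪̂_K)^ι} = ∏_v 1_{localCosetBox_v}`.
[folklore] -/
theorem piProd_cosetFamily {𝔫 : Ideal (𝓞 K)} (h𝔫 : 𝔫 ≠ 0) (c : ι → FiniteAdeleRing (𝓞 K) K) :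
    piProd K ι (cosetFamily K ι h𝔫 c) =
      ((fun x => x - c) ⁻¹' (piLevelIdeal K ι 𝔫 : Set (ι → FiniteAdeleRing (𝓞 K) K))).indicator
        fun _ => 1 := by
  funext x
  by_cases hx : x - c ∈ piLevelIdeal K ι 𝔫
  · rw [piProd_cosetFamily_of_mem K ι h𝔫 hx, Set.indicator_of_mem (by exact hx)]
  · rw [piProd_cosetFamily_of_notMem K ι h𝔫 hx, Set.indicator_of_notMem (by exact hx)]

/-- The **pure tensor** `∏_v Φ_v` as an element of the finite-adelic Schwartz–Bruhat space
`𝒮((𝔸_{K,f})^ι)`. [folklore] -/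
def piProdSB (Φ : LocalSBFamily K ι) : ↥(SchwartzBruhat (ι → FiniteAdeleRing (𝓞 K) K)) :=
  ⟨piProd K ι Φ, piProd_mem_schwartzBruhat Φ⟩

/-- Underlying function of the bundled pure tensor. [folklore] -/
@[simp] theorem coe_piProdSB (Φ : LocalSBFamily K ι) :
    ((piProdSB K ι Φ : ↥(SchwartzBruhat (ι → FiniteAdeleRing (𝓞 K) K))) :
      (ι → FiniteAdeleRing (𝓞 K) K) → ℂ) = piProd K ι Φ := rfl

end Coset

/-! ### Every Schwartz–Bruhat function on `(𝔸_{K,f})^ι` is a finite sum of pure tensors -/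

section Span

variable (K : Type) [Field K] [NumberField K] (ι : Type) [Fintype ι]

/-- **Factorizable functions span**: a Schwartz–Bruhat function `F` on `(𝔸_{K,f})^ι` is a finite
linear combination of pure tensors — indeed of coset indicators `1_{c + (𝔫𝒪̂_K)^ι}` for a level
`𝔫` of `F` (`exists_level_of_mem_schwartzBruhat`) and finitely many cosets covering its support
(Tate's thesis §4.2 / Weil's standard functions; Bump §3.5). [folklore] -/
theorem mem_span_range_piProd {F : (ι → FiniteAdeleRing (𝓞 K) K) → ℂ}
    (hF : F ∈ SchwartzBruhat (ι → FiniteAdeleRing (𝓞 K) K)) :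
    F ∈ Submodule.span ℂ (Set.range (piProd K ι)) := by
  classical
  obtain ⟨𝔫, h𝔫, hlev⟩ := exists_level_of_mem_schwartzBruhat K hF
  obtain ⟨-, hcs⟩ := mem_schwartzBruhat_iff.mp hF
  -- finitely many cosets of the level box cover the support
  obtain ⟨T, hT⟩ := hcs.isCompact.elim_finite_subcover
    (fun c : ι → FiniteAdeleRing (𝓞 K) K => (fun x => x - c) ⁻¹'
      (piLevelIdeal K ι 𝔫 : Set (ι → FiniteAdeleRing (𝓞 K) K)))
    (fun c => (isOpen_piLevelIdeal K 𝔫).preimage (continuous_sub_right c))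
    (fun x _ => mem_iUnion.mpr ⟨x, by simp⟩)
  -- the distinct cosets met
  let s : Finset ((ι → FiniteAdeleRing (𝓞 K) K) ⧸ piLevelIdeal K ι 𝔫) :=
    T.image (QuotientAddGroup.mk : (ι → FiniteAdeleRing (𝓞 K) K) → _)
  have hrepr : F = ∑ q ∈ s, F q.out • piProd K ι (cosetFamily K ι h𝔫 q.out) := by
    funext x
    rw [Finset.sum_apply]
    simp only [Pi.smul_apply, smul_eq_mul]
    by_cases hx : (QuotientAddGroup.mk x : (ι → FiniteAdeleRing (𝓞 K) K) ⧸ piLevelIdeal K ι 𝔫) ∈ s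
    · rw [Finset.sum_eq_single_of_mem _ hx]
      · have hmem : x - (QuotientAddGroup.mk x :
            (ι → FiniteAdeleRing (𝓞 K) K) ⧸ piLevelIdeal K ι 𝔫).out ∈ piLevelIdeal K ι 𝔫 := by
          rw [← QuotientAddGroup.eq_iff_sub_mem, QuotientAddGroup.out_eq']
        rw [piProd_cosetFamily_of_mem K ι h𝔫 hmem, mul_one]
        have h := hlev ((QuotientAddGroup.mk x :
            (ι → FiniteAdeleRing (𝓞 K) K) ⧸ piLevelIdeal K ι 𝔫).out) _ hmem
        rw [add_sub_cancel] at h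
        exact h
      · intro q _ hne
        rw [piProd_cosetFamily_of_notMem K ι h𝔫, mul_zero]
        intro hmem
        apply hne
        rw [← QuotientAddGroup.out_eq' q]
        exact (QuotientAddGroup.eq_iff_sub_mem.mpr hmem).symm
    · have hx0 : F x = 0 := by
        refine image_eq_zero_of_notMem_tsupport fun hxC => hx ?_
        obtain ⟨c, hcT, hxc⟩ := mem_iUnion₂.mp (hT hxC)
        exact Finset.mem_image.mpr ⟨c, hcT, (QuotientAddGroup.eq_iff_sub_mem.mpr hxc).symm⟩
      rw [hx0]
      symm
      refine Finset.sum_eq_zero fun q hq => ?_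
      rw [piProd_cosetFamily_of_notMem K ι h𝔫, mul_zero]
      intro hmem
      apply hx
      have hq' : (QuotientAddGroup.mk x : (ι → FiniteAdeleRing (𝓞 K) K) ⧸ piLevelIdeal K ι 𝔫) = q := by
        rw [← QuotientAddGroup.out_eq' q]
        exact QuotientAddGroup.eq_iff_sub_mem.mpr hmem
      rw [hq']
      exact hq
  rw [hrepr]
  exact Submodule.sum_mem _ fun q _ =>
    Submodule.smul_mem _ _ (Submodule.subset_span ⟨cosetFamily K ι h𝔫 q.out, rfl⟩)

/-- **The pure tensors span exactly the Schwartz–Bruhat space** of `(𝔸_{K,f})^ι` (as a space of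
functions). [folklore] -/
theorem span_range_piProd_eq :
    Submodule.span ℂ (Set.range (piProd K ι)) = SchwartzBruhat (ι → FiniteAdeleRing (𝓞 K) K) := by
  refine le_antisymm (Submodule.span_le.mpr ?_) fun F hF => mem_span_range_piProd K ι hF
  rintro _ ⟨Φ, rfl⟩
  exact piProd_mem_schwartzBruhat Φ

/-- **The bundled pure tensors span `𝒮((𝔸_{K,f})^ι)`.** [folklore] -/
theorem span_range_piProdSB :
    Submodule.span ℂ (Set.range (piProdSB K ι)) = ⊤ := by
  refine Submodule.eq_top_iff'.mpr fun F => ?_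
  have hF : (F : (ι → FiniteAdeleRing (𝓞 K) K) → ℂ) ∈ Submodule.span ℂ (Set.range (piProd K ι)) :=
    mem_span_range_piProd K ι F.2
  have hrange : Set.range (piProd K ι) =
      (SchwartzBruhat (ι → FiniteAdeleRing (𝓞 K) K)).subtype '' Set.range (piProdSB K ι) := by
    ext f
    constructor
    · rintro ⟨Φ, rfl⟩
      exact ⟨piProdSB K ι Φ, ⟨Φ, rfl⟩, rfl⟩
    · rintro ⟨G, ⟨Φ, rfl⟩, rfl⟩
      exact ⟨Φ, rfl⟩
  rw [hrange, Submodule.span_image] at hF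
  obtain ⟨G, hG, hGF⟩ := hF
  have hGF' : G = F := Subtype.ext hGF
  rw [← hGF']
  exact hG

end Span

end Literature.NumberTheory.Automorphic

end
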